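import Summits.QuantumFields.YangMills.Theorems.BalabanUVNodesK0AxTransverseWard

/-!
# K0ᴬ TRANSVERSE WARD READ-OUT — PART 2: THE RECORD-FACING ROAD RE-RUN ON TRANSVERSE LEGS (NODE v8 (A), §6∕§7′ of ◇ lens-1 g7's companion v2 `b4441b0d63812759`)

Continuation of `…/Theorems/BalabanUVNodesK0AxTransverseWard.lean` (same namespace, same custody: ◆ CRIT-1 g35 06:03:20Z PASS ×4 ∕ 06:07:00Z; landed by porter
`ymgap-nodeO-port-PTB-1` g4, `--supports stmt-QuantumFields-27238 --as helper`).  ★★★ `Road.decay510_plimOf_of_rows_transverse` ∕ ★★★ `Road.decay510_plimOf_of_rows_transverseSymm`: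
the tree road `PortH.decay510_plimOf_of_rows` (✓ `…PortHDecayOfRows.lean` :117) with its binder list BYTE-IDENTICAL except (◆'s mechanical diff): + `{P}`∕`gradLeg`,
+ ONE structural row `(hfl : ChartGaugeFlow act coords χ gradLeg)` ([I] (4.8), `Literature/…/B12ChartGaugeFlow48`), and RowL «`R.Gk n (R.e n μ z) = Dιₙ(0)δ_{μz}`» ↦ RowLᵀ
«`∃ p, Dιₙ(0)δ_{μz} − R.Gk n (R.e n μ z) = gradLeg n p`» (resp. RowLᵀ♯ with one global chart symmetry `T` per member); SAME conclusion
`Decay510 (plimOf … 0 1) (16·E₀·C₉²·e^{δ₁Mg c₁}·K₀·K₁) δ₁`.  Compatibility certificates `chartGaugeFlow_trivial`, `decay510_plimOf_of_rows_of_transverse`,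
`decay510_plimOf_of_rows_transverse_of_symm` (the tree road is the special case; no junk inhabitant).  So the `Response9D` rows may be read on the selector-free transverse table
`{recordResponse9DataFromL … with Gk := fun n => recordGkLocWξ … (K₀+n) Finset.univ a}` (✓`PortU8.rowR4D_LocUniv_sandwich`, `PortU8.response9D_LocUniv_of_tokens`) once leaves
(B) `ChartGaugeFlow recordAct recordCoords recordChartJ recordGradLeg` and (C)♯ (the RowLᵀ♯ instance, BLOCKED-ON P0) are supplied at the record.
[I] = [Balaban1987RG1], [15] = [Balaban1985Variational], [B6] = [Balaban1984PropagatorsII].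

HONEST FRAMING.  Generic implications over DISPLAYED rows; NOTHING of Bałaban ([I] Thm 1, (1.19)–(1.22), (4.8), (4.14)–(4.15), (4.35)–(4.37), (5.10); [15] Thm 1, Prop. 9,
(190); [B6] Prop. 2.5 AT THE RECORD) is asserted, ported or discharged; typed ≠ proved; K0ᴬ `Record13SepCoPHInhabitedAx` (stmt-QuantumFields-27238) OPEN; NODE O 0∕1;
COUNT 8∕28 · K 1∕4 UNMOVED; ONE finite `𝕋⁴_{L^K}` at fixed ε — NOT continuum ∕ OS ∕ Clay; **the Yang–Mills mass gap (Clay) is NOT proved by any of this.**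
-/

noncomputable section

open scoped BigOperators Topology
open Set Filter Metric

namespace Summit.QuantumFields.YangMills.Theorems.K0AxTransverseWard

open Literature.MathematicalPhysics.QuantumFieldTheory.Balaban1983to89.B12ChartGaugeFlow48

open Literature.MathematicalPhysics.QuantumFieldTheory.Balaban1983to89
open Literature.MathematicalPhysics.QuantumFieldTheory.Balaban1983to89.B12Decay510 (SiteGeometry KernelBound GeomLeaf CubeSumLeaf TreeLeaf delta1 mixedDeriv
  abs_twoPoint_le_delta1)
open Literature.MathematicalPhysics.QuantumFieldTheory.Balaban1983to89.B12Decay510Gauge (kernelBound_of_gauge)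
open Literature.MathematicalPhysics.QuantumFieldTheory.Balaban1983to89.Beta.RemainderLocality (mixedDeriv_eq_fderiv_fderiv)
open Literature.MathematicalPhysics.QuantumFieldTheory.Balaban1983to89.B12FormatPlus

/-! ## §6  THE RECORD-FACING ROAD RE-RUN ON TRANSVERSE LEGS (drop-in variant of `PortH.decay510_plimOf_of_rows`) -/

namespace Road

open Literature.MathematicalPhysics.QuantumFieldTheory.Balaban1983to89.Node00 (TermFamily1 siteOfInt)
open Literature.MathematicalPhysics.QuantumFieldTheory.Balaban1983to89.T4Continuum (T4Family)
open Literature.MathematicalPhysics.QuantumFieldTheory.Balaban1983to89.B12Decay510 (decay510_of_tendsto)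
open Literature.MathematicalPhysics.QuantumFieldTheory.Balaban1983to89.B12Eq435SecondVariation (ofReal_fderiv_fderiv_eq_sum_mixedDeriv_of_repr)
open Literature.MathematicalPhysics.QuantumFieldTheory.Balaban1983to89.Beta.RemainderLocality (mixedDeriv_comp_clm)
open Summit.QuantumFields.YangMills.Theorems.K0RecordFormatNames (ΦfOf pvolOf plimOf)
open Summit.QuantumFields.YangMills.Theorems.BalabanUVNodesPortS1 (ward414_of_gaugeInv119_chart44D)
open Summit.QuantumFields.YangMills.Theorems.PortH (exists_cutTo_clm)

variable (F : T4Family) {𝔄 : Type} [NormedRing 𝔄] [NormedAlgebra ℝ 𝔄] {V : Type} [NormedAddCommGroup V] [NormedSpace ℝ V] {ι : Type} [Fintype ι]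
  (fam : TermFamily1 F 𝔄) (ρ : V →L[ℝ] 𝔄) (bV : Module.Basis ι ℝ V) (aStar : ι) (k : ℕ) (v : Fin (k + 1) → ℝ)
  {S : ℕ → LocDomainSys} {M m : ℕ → ℕ}

/-- ★ **(4.37) AT A REAL HISTORY, PER VOLUME — TRANSVERSE LEGS**: as `PortH.pvolOf_eq_sum_re_mixedDeriv`, with RowL replaced by RowLᵀ «the honest
response `Dιₙ(0)δ_{μz}` and the tabulated leg `R.Gk n (e μ z)` differ by a pure-gauge leg» + (1.19) for the pieces + the chart-level gauge flow:
`pvolOf … (K n) 0 1 z = Σ_X Re ∂²(𝐄ₙ(X)∘χ_X)[hₙ(X, e 1 0), hₙ(X, e 0 z)]` on the CUT TABULATED (transverse) legs.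
[cite: Balaban1987RG1, (4.35) p.290, (4.37) p.291, (4.15) p.284, (1.19)–(1.20) pp.263–264, (1.7) p.261] -/
theorem pvolOf_eq_sum_re_mixedDeriv_transverse (Uc : (n : ℕ) → (S n).Dom → Set (Fin (M n) → ℂ)) (coords : (n : ℕ) → (S n).Dom → Finset (Fin (M n)))
    (χ : (n : ℕ) → (S n).Dom → (Fin (m n) → ℂ) → (Fin (M n) → ℂ)) (D : (n : ℕ) → (S n).Dom → Set (Fin (m n) → ℂ))
    {Gg P : ℕ → Type*} (act : (n : ℕ) → Gg n → (Fin (M n) → ℂ) → (Fin (M n) → ℂ)) (gradLeg : (n : ℕ) → P n → (Fin (m n) → ℂ))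
    (E : Pieces S M) (R : Response9Data S M m 4) (K : ℕ → ℕ)
    (ιe : (n : ℕ) → (Fin (F.P (K n)).d → Site (F.P (K n)) (k + 1) → V) → (Fin (m n) → ℂ))
    (hAn : Analytic19 Uc E) (hLoc : Local17 coords E) (hRep : Repr17 S E χ (fun n => ΦfOf F fam ρ k v (K n)) ιe) (hW : Ward414 χ E)
    (hGI : GaugeInv119 act Uc E) (hfl : ChartGaugeFlow act coords χ gradLeg)
    (hC : Chart44D S M Uc m χ D) (hcut : ∀ n X u, ∀ i ∈ coords n X, χ n X (cutTo (R.cX n X) u) i = χ n X u i)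
    (hL : ∀ n, ιe n 0 = 0 ∧ ContDiffAt ℝ 2 (ιe n) 0 ∧ ∀ (μ : Fin 4) (z : Fin 4 → ℤ), ∃ p : P n,
      fderiv ℝ (ιe n) 0 (Pi.single (Fin.cast (F.P_d (K n)).symm μ) (Pi.single (siteOfInt F (K n) (k + 1) z) (bV aStar))) - R.Gk n (R.e n μ z) =
        gradLeg n p)
    (hS : ∀ (n : ℕ) (z : Fin 4 → ℤ), pvolOf F fam ρ bV k v (K n) 0 1 z =
      B12PolarizationTensor120.polComp ℝ (B12PolarizationTensor120.expChart (fam k v (K n)) ρ) bV (Fin.cast (F.P_d (K n)).symm 0)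
        (siteOfInt F (K n) (k + 1) z) aStar (Fin.cast (F.P_d (K n)).symm 1) (siteOfInt F (K n) (k + 1) 0) aStar)
    (n : ℕ) (z : Fin 4 → ℤ) :
    pvolOf F fam ρ bV k v (K n) 0 1 z =
      ∑ X, (mixedDeriv (fun u => E n X (χ n X u)) (cutTo (R.cX n X) (R.Gk n (R.e n 1 0))) (cutTo (R.cX n X) (R.Gk n (R.e n 0 z)))).re := by
  classical
  obtain ⟨hι0, hιC2, hGk⟩ := hL n
  have hF : ∀ X, AnalyticAt ℂ (fun u => E n X (χ n X u)) 0 := fun X =>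
    analyticOnNhd_piece_chart hC hAn n X 0 (hC n X).2.2.2.1
  have hrepr : (fun B => ((B12PolarizationTensor120.expChart (fam k v (K n)) ρ B : ℝ) : ℂ)) =ᶠ[𝓝 0]
      fun B => ∑ X, (fun u => E n X (χ n X u)) (ιe n B) := hRep n
  set p : Fin (F.P (K n)).d → Site (F.P (K n)) (k + 1) → V :=
    Pi.single (Fin.cast (F.P_d (K n)).symm 0) (Pi.single (siteOfInt F (K n) (k + 1) z) (bV aStar)) with hp
  set q : Fin (F.P (K n)).d → Site (F.P (K n)) (k + 1) → V :=
    Pi.single (Fin.cast (F.P_d (K n)).symm 1) (Pi.single (siteOfInt F (K n) (k + 1) 0) (bV aStar)) with hq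
  have hbridge := (ofReal_fderiv_fderiv_eq_sum_mixedDeriv_of_repr (fun X u => E n X (χ n X u)) (ιe n) _ hrepr hι0 hιC2 hF (hW n) p q).2
  have hpv : (pvolOf F fam ρ bV k v (K n) 0 1 z : ℂ) =
      ∑ X, mixedDeriv (fun u => E n X (χ n X u)) (fderiv ℝ (ιe n) 0 q) (fderiv ℝ (ιe n) 0 p) := by
    rw [hS n z]; exact hbridge
  -- RowLᵀ + W2♭: swap the honest legs `Dιₙ(0)q`, `Dιₙ(0)p` for the tabulated (transverse) legs
  have hswap : ∑ X, mixedDeriv (fun u => E n X (χ n X u)) (fderiv ℝ (ιe n) 0 q) (fderiv ℝ (ιe n) 0 p) =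
      ∑ X, mixedDeriv (fun u => E n X (χ n X u)) (R.Gk n (R.e n 1 0)) (R.Gk n (R.e n 0 z)) :=
    sum_mixedDeriv_congr_of_gaugeLegs hGI hLoc hfl hC hAn hW n (hGk 1 0) (hGk 0 z)
  rw [hswap] at hpv
  -- the cut: `F_X ∘ cutTo = F_X` by (A3) + (1.7)
  have hcutEq : ∀ X (a b : Fin (m n) → ℂ), mixedDeriv (fun u => E n X (χ n X u)) a b =
      mixedDeriv (fun u => E n X (χ n X u)) (cutTo (R.cX n X) a) (cutTo (R.cX n X) b) := by
    intro X a b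
    obtain ⟨T, hT⟩ := exists_cutTo_clm (R.cX n X)
    have hfun : (fun u => E n X (χ n X u)) = fun u => (fun u => E n X (χ n X u)) (T u) := by
      funext u; rw [hT]; exact (hLoc n X _ _ fun i hi => (hcut n X u i hi)).symm
    obtain ⟨r, hr, hball⟩ : ∃ r > 0, ∀ y ∈ Metric.ball (0 : Fin (m n) → ℂ) r, DifferentiableAt ℂ (fun u => E n X (χ n X u)) y := by
      obtain ⟨s, hs, hsub⟩ := Metric.mem_nhds_iff.1 (hF X).eventually_analyticAt
      exact ⟨s, hs, fun y hy => (hsub hy).differentiableAt⟩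
    conv_lhs => rw [hfun]
    rw [mixedDeriv_comp_clm hr hball T a b, hT, hT]
  have hsum : ∑ X, mixedDeriv (fun u => E n X (χ n X u)) (R.Gk n (R.e n 1 0)) (R.Gk n (R.e n 0 z)) =
      ∑ X, mixedDeriv (fun u => E n X (χ n X u)) (cutTo (R.cX n X) (R.Gk n (R.e n 1 0))) (cutTo (R.cX n X) (R.Gk n (R.e n 0 z))) :=
    Finset.sum_congr rfl fun X _ => hcutEq X _ _
  rw [hsum] at hpv
  have := congrArg Complex.re hpv
  rw [Complex.ofReal_re, Complex.re_sum] at this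
  exact this

/-- ★★★ **THE DECAY ROAD ON TRANSVERSE LEGS** — `PortH.decay510_plimOf_of_rows` with the response rows `Response9D R …` displayed on a table `R.Gk` that
agrees with the honest linearisation of the embedding only MODULO PURE-GAUGE LEGS (RowLᵀ) and ONE structural row `ChartGaugeFlow` ([I] (4.8)):
(1.19)-mould ∧ `Chart44D` ∧ chart equivariance ∧ «G semisimple» ∧ (A3) ∧ `Response9D` (gauge currency, ON THE TRANSVERSE TABLE) ∧ leaves ∧ window isometry
∧ RowLᵀ ∧ RowS ∧ (1.21) ⟹ `Decay510 (plimOf F fam ρ bV k v 0 1) (16·E₀·C₉²·e^{δ₁Mg c₁}·K₀·K₁) δ₁`, `δ₁ = ½ min{δ₀, κ∕Mg}`.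
[cite: Balaban1987RG1, (5.10) p.293, (4.35)–(4.37) pp.290–291, (4.8) p.283, (4.14)–(4.15) p.284, (1.18)–(1.21) pp.263–264; Balaban1985Variational, Prop. 9 p.309;
Balaban1984PropagatorsII, Prop. 2.5 (the decay the transverse rows carry)] -/
theorem decay510_plimOf_of_rows_transverse (Uc : (n : ℕ) → (S n).Dom → Set (Fin (M n) → ℂ)) (coords : (n : ℕ) → (S n).Dom → Finset (Fin (M n)))
    (χ : (n : ℕ) → (S n).Dom → (Fin (m n) → ℂ) → (Fin (M n) → ℂ)) (D : (n : ℕ) → (S n).Dom → Set (Fin (m n) → ℂ))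
    {Gg P : ℕ → Type*} (act : (n : ℕ) → Gg n → (Fin (M n) → ℂ) → (Fin (M n) → ℂ)) {Hg : ℕ → Type*} (toG : (n : ℕ) → Hg n → Gg n)
    (A : (n : ℕ) → Hg n → ((Fin (m n) → ℂ) →L[ℂ] (Fin (m n) → ℂ))) (gradLeg : (n : ℕ) → P n → (Fin (m n) → ℂ))
    (R : Response9Data S M m 4) (Nw K : ℕ → ℕ)
    (ιe : (n : ℕ) → (Fin (F.P (K n)).d → Site (F.P (K n)) (k + 1) → V) → (Fin (m n) → ℂ))
    {E₀ κ C₉ δ₀ Mg c₁ K₀ K₁ : ℝ} (hE₀ : 0 ≤ E₀) (hκ : 0 ≤ κ) (hδ₀ : 0 ≤ δ₀) (hMg : 0 < Mg) (hK₀ : 0 ≤ K₀)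
    (hA : FormatPlusG S M act Uc coords m χ (fun n => ΦfOf F fam ρ k v (K n)) ιe R.wrap R.emb R.πc E₀ κ)
    (hC : Chart44D S M Uc m χ D) (hEq : ChartEquivariant toG act χ A) (hN : ∀ n, NoInvariantCovector (A n))
    (hfl : ChartGaugeFlow act coords χ gradLeg)
    (hcut : ∀ n X u, ∀ i ∈ coords n X, χ n X (cutTo (R.cX n X) u) i = χ n X u i)
    (hR : Response9D R χ Nw D C₉ δ₀)
    (hgeo : ∀ n, GeomLeaf (R.G n) (R.ρ n) Mg c₁) (hcube : ∀ n, CubeSumLeaf (R.G n) (δ₀ / 2) K₁) (htree : ∀ n, TreeLeaf (R.Cc n) (κ / 2) K₀)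
    (hρ : ∀ (μ ν : Fin 4) (z : Fin 4 → ℤ), ∀ᶠ n in atTop, R.ρ n (R.e n μ 0) (R.e n ν z) = B12Sec2to5.l1 z)
    (hL : ∀ n, ιe n 0 = 0 ∧ ContDiffAt ℝ 2 (ιe n) 0 ∧ ∀ (μ : Fin 4) (z : Fin 4 → ℤ), ∃ p : P n,
      fderiv ℝ (ιe n) 0 (Pi.single (Fin.cast (F.P_d (K n)).symm μ) (Pi.single (siteOfInt F (K n) (k + 1) z) (bV aStar))) - R.Gk n (R.e n μ z) =
        gradLeg n p)
    (hS : ∀ (n : ℕ) (z : Fin 4 → ℤ), pvolOf F fam ρ bV k v (K n) 0 1 z =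
      B12PolarizationTensor120.polComp ℝ (B12PolarizationTensor120.expChart (fam k v (K n)) ρ) bV (Fin.cast (F.P_d (K n)).symm 0)
        (siteOfInt F (K n) (k + 1) z) aStar (Fin.cast (F.P_d (K n)).symm 1) (siteOfInt F (K n) (k + 1) 0) aStar)
    (hLim : Limit121 (fun n => pvolOf F fam ρ bV k v (K n)) (plimOf F fam ρ bV k v)) :
    B12Sec2to5.Decay510 (plimOf F fam ρ bV k v 0 1) (16 * E₀ * C₉ ^ 2 * Real.exp (delta1 δ₀ κ Mg * Mg * c₁) * K₀ * K₁) (delta1 δ₀ κ Mg) := by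
  obtain ⟨E, hAn, hB, hLoc, hRep, -, hG⟩ := hA
  have hW : Ward414 χ E := ward414_of_gaugeInv119_chart44D hG hEq hC hAn hN
  have hC₉ : 0 ≤ C₉ := hR.consts_nonneg.1
  refine decay510_of_tendsto (fun n z => pvolOf F fam ρ bV k v (K n) 0 1 z) (fun z => hLim 0 1 z) fun z => ?_
  filter_upwards [hρ 1 0 z] with n hn
  rw [pvolOf_eq_sum_re_mixedDeriv_transverse F fam ρ bV aStar k v Uc coords χ D act gradLeg E R K ιe hAn hLoc hRep hW hG hfl hC hcut hL hS n z,
    ← hn]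
  have hD : ∀ X : (S n).Dom, Convex ℝ (D n X) ∧ Balanced ℂ (D n X) ∧ IsOpen (D n X) ∧ (0 : Fin (m n) → ℂ) ∈ D n X := fun X => by
    obtain ⟨h1, h2, h3, h4, -, -⟩ := hC n X; exact ⟨h1, h2, h3, h4⟩
  have han : ∀ X : (S n).Dom, AnalyticOnNhd ℂ (fun u => E n X (χ n X u)) (D n X) := fun X => analyticOnNhd_piece_chart hC hAn n X
  have h118 : ∀ X : (S n).Dom, ∀ w ∈ D n X, ‖E n X (χ n X w)‖ ≤ E₀ * Real.exp (-κ * (S n).dj X) := fun X w hw => by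
    obtain ⟨-, -, -, -, -, hmaps⟩ := hC n X
    exact (bound118_iff Uc E E₀ κ).1 hB n X _ (hmaps hw)
  exact B12Decay510Gauge.abs_twoPoint_le_of_gauge (R.G n) (ρ := R.ρ n) (fun X u => E n X (χ n X u)) (D n) (fun X y => cutTo (R.cX n X) (R.Gk n y))
    (fun X x y => (mixedDeriv (fun u => E n X (χ n X u)) (cutTo (R.cX n X) (R.Gk n x)) (cutTo (R.cX n X) (R.Gk n y))).re)
    hE₀ hC₉ hK₀ hδ₀ hκ hMg hD han h118 (fun _ _ _ => rfl) (fun X y => hR.decay n X y) (hgeo n) (hcube n) (htree n) _ _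

/-- **COMPATIBILITY ∕ NON-VACUITY CERTIFICATE (cell rule (N)).**  The chart-level gauge flow is inhabited by the TRIVIAL flow (`γ ≡ e` with `act n e = id`,
`φ t = id`, pure-gauge legs `0`), under which RowLᵀ is RowL: so the transverse road SPECIALISES to the tree road `PortH.decay510_plimOf_of_rows` — the two
new rows cost nothing when the honest legs already decay, and carry exactly the gauge freedom when they do not.  (No junk inhabitant is used: the
pieces, chart, action and rows are the caller's.) [cite: Balaban1987RG1, (4.8) p.283 (λ = 0), (5.10) p.293] -/
theorem chartGaugeFlow_trivial {Gg : ℕ → Type*} (act : (n : ℕ) → Gg n → (Fin (M n) → ℂ) → (Fin (M n) → ℂ))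
    (coords : (n : ℕ) → (S n).Dom → Finset (Fin (M n))) (χ : (n : ℕ) → (S n).Dom → (Fin (m n) → ℂ) → (Fin (M n) → ℂ))
    (e : (n : ℕ) → Gg n) (he : ∀ n u, act n (e n) u = u) :
    ChartGaugeFlow act coords χ (fun n (_ : Unit) => (0 : Fin (m n) → ℂ)) := by
  intro n _
  refine ⟨fun _ => e n, fun _ u => u, fun _ => ContinuousLinearMap.id ℂ _, ?_, ?_, rfl, ?_⟩
  · exact Filter.Eventually.of_forall fun t X => Filter.Eventually.of_forall fun u i _ => by rw [he]
  · exact Filter.Eventually.of_forall fun t => ⟨hasFDerivAt_id (𝕜 := ℂ) 0, fun v => ⟨v, rfl⟩⟩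
  · simpa using hasDerivAt_const (0 : ℝ) (0 : Fin (m n) → ℂ)

/-- The tree road recovered from the transverse road (RowL ⟹ RowLᵀ with zero pure-gauge legs + the trivial flow). [cite: Balaban1987RG1, (5.10) p.293] -/
theorem decay510_plimOf_of_rows_of_transverse (Uc : (n : ℕ) → (S n).Dom → Set (Fin (M n) → ℂ)) (coords : (n : ℕ) → (S n).Dom → Finset (Fin (M n)))
    (χ : (n : ℕ) → (S n).Dom → (Fin (m n) → ℂ) → (Fin (M n) → ℂ)) (D : (n : ℕ) → (S n).Dom → Set (Fin (m n) → ℂ))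
    {Gg : ℕ → Type*} (act : (n : ℕ) → Gg n → (Fin (M n) → ℂ) → (Fin (M n) → ℂ)) {Hg : ℕ → Type*} (toG : (n : ℕ) → Hg n → Gg n)
    (A : (n : ℕ) → Hg n → ((Fin (m n) → ℂ) →L[ℂ] (Fin (m n) → ℂ))) (e : (n : ℕ) → Gg n) (he : ∀ n u, act n (e n) u = u)
    (R : Response9Data S M m 4) (Nw K : ℕ → ℕ)
    (ιe : (n : ℕ) → (Fin (F.P (K n)).d → Site (F.P (K n)) (k + 1) → V) → (Fin (m n) → ℂ))
    {E₀ κ C₉ δ₀ Mg c₁ K₀ K₁ : ℝ} (hE₀ : 0 ≤ E₀) (hκ : 0 ≤ κ) (hδ₀ : 0 ≤ δ₀) (hMg : 0 < Mg) (hK₀ : 0 ≤ K₀)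
    (hA : FormatPlusG S M act Uc coords m χ (fun n => ΦfOf F fam ρ k v (K n)) ιe R.wrap R.emb R.πc E₀ κ)
    (hC : Chart44D S M Uc m χ D) (hEq : ChartEquivariant toG act χ A) (hN : ∀ n, NoInvariantCovector (A n))
    (hcut : ∀ n X u, ∀ i ∈ coords n X, χ n X (cutTo (R.cX n X) u) i = χ n X u i)
    (hR : Response9D R χ Nw D C₉ δ₀)
    (hgeo : ∀ n, GeomLeaf (R.G n) (R.ρ n) Mg c₁) (hcube : ∀ n, CubeSumLeaf (R.G n) (δ₀ / 2) K₁) (htree : ∀ n, TreeLeaf (R.Cc n) (κ / 2) K₀)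
    (hρ : ∀ (μ ν : Fin 4) (z : Fin 4 → ℤ), ∀ᶠ n in atTop, R.ρ n (R.e n μ 0) (R.e n ν z) = B12Sec2to5.l1 z)
    (hL : ∀ n, ιe n 0 = 0 ∧ ContDiffAt ℝ 2 (ιe n) 0 ∧ ∀ (μ : Fin 4) (z : Fin 4 → ℤ),
      R.Gk n (R.e n μ z) = fderiv ℝ (ιe n) 0 (Pi.single (Fin.cast (F.P_d (K n)).symm μ) (Pi.single (siteOfInt F (K n) (k + 1) z) (bV aStar))))
    (hS : ∀ (n : ℕ) (z : Fin 4 → ℤ), pvolOf F fam ρ bV k v (K n) 0 1 z =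
      B12PolarizationTensor120.polComp ℝ (B12PolarizationTensor120.expChart (fam k v (K n)) ρ) bV (Fin.cast (F.P_d (K n)).symm 0)
        (siteOfInt F (K n) (k + 1) z) aStar (Fin.cast (F.P_d (K n)).symm 1) (siteOfInt F (K n) (k + 1) 0) aStar)
    (hLim : Limit121 (fun n => pvolOf F fam ρ bV k v (K n)) (plimOf F fam ρ bV k v)) :
    B12Sec2to5.Decay510 (plimOf F fam ρ bV k v 0 1) (16 * E₀ * C₉ ^ 2 * Real.exp (delta1 δ₀ κ Mg * Mg * c₁) * K₀ * K₁) (delta1 δ₀ κ Mg) :=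
  decay510_plimOf_of_rows_transverse F fam ρ bV aStar k v Uc coords χ D act toG A (fun n (_ : Unit) => (0 : Fin (m n) → ℂ)) R Nw K ιe
    hE₀ hκ hδ₀ hMg hK₀ hA hC hEq hN (chartGaugeFlow_trivial act coords χ e he) hcut hR hgeo hcube htree hρ
    (fun n => ⟨(hL n).1, (hL n).2.1, fun μ z => ⟨(), by rw [(hL n).2.2 μ z, sub_self]⟩⟩) hS hLim

/-! ### §7′  The road with RowLᵀ♯ (gradients AND one global chart symmetry per member) -/

/-- ★ (4.37) per volume with RowLᵀ♯: as `pvolOf_eq_sum_re_mixedDeriv_transverse`, the honest legs congruent to the tabulated legs modulo pure-gauge legs and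
ONE chart symmetry `T n` per member. [cite: Balaban1987RG1, (4.35) p.290, (4.37) p.291, (4.15) p.284, (4.8) p.283, (1.19)–(1.20) pp.263–264, (1.7) p.261] -/
theorem pvolOf_eq_sum_re_mixedDeriv_transverseSymm (Uc : (n : ℕ) → (S n).Dom → Set (Fin (M n) → ℂ)) (coords : (n : ℕ) → (S n).Dom → Finset (Fin (M n)))
    (χ : (n : ℕ) → (S n).Dom → (Fin (m n) → ℂ) → (Fin (M n) → ℂ)) (D : (n : ℕ) → (S n).Dom → Set (Fin (m n) → ℂ))
    {Gg P : ℕ → Type*} (act : (n : ℕ) → Gg n → (Fin (M n) → ℂ) → (Fin (M n) → ℂ)) (gradLeg : (n : ℕ) → P n → (Fin (m n) → ℂ))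
    (E : Pieces S M) (R : Response9Data S M m 4) (K : ℕ → ℕ)
    (ιe : (n : ℕ) → (Fin (F.P (K n)).d → Site (F.P (K n)) (k + 1) → V) → (Fin (m n) → ℂ))
    (hAn : Analytic19 Uc E) (hLoc : Local17 coords E) (hRep : Repr17 S E χ (fun n => ΦfOf F fam ρ k v (K n)) ιe) (hW : Ward414 χ E)
    (hGI : GaugeInv119 act Uc E) (hfl : ChartGaugeFlow act coords χ gradLeg)
    (hC : Chart44D S M Uc m χ D) (hcut : ∀ n X u, ∀ i ∈ coords n X, χ n X (cutTo (R.cX n X) u) i = χ n X u i)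
    (hL : ∀ n, ιe n 0 = 0 ∧ ContDiffAt ℝ 2 (ιe n) 0 ∧ ∃ T : (Fin (m n) → ℂ) →L[ℂ] (Fin (m n) → ℂ), ChartSymm act χ n T ∧
      ∀ (μ : Fin 4) (z : Fin 4 → ℤ), ∃ p : P n,
        fderiv ℝ (ιe n) 0 (Pi.single (Fin.cast (F.P_d (K n)).symm μ) (Pi.single (siteOfInt F (K n) (k + 1) z) (bV aStar))) - T (R.Gk n (R.e n μ z)) =
          gradLeg n p)
    (hS : ∀ (n : ℕ) (z : Fin 4 → ℤ), pvolOf F fam ρ bV k v (K n) 0 1 z =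
      B12PolarizationTensor120.polComp ℝ (B12PolarizationTensor120.expChart (fam k v (K n)) ρ) bV (Fin.cast (F.P_d (K n)).symm 0)
        (siteOfInt F (K n) (k + 1) z) aStar (Fin.cast (F.P_d (K n)).symm 1) (siteOfInt F (K n) (k + 1) 0) aStar)
    (n : ℕ) (z : Fin 4 → ℤ) :
    pvolOf F fam ρ bV k v (K n) 0 1 z =
      ∑ X, (mixedDeriv (fun u => E n X (χ n X u)) (cutTo (R.cX n X) (R.Gk n (R.e n 1 0))) (cutTo (R.cX n X) (R.Gk n (R.e n 0 z)))).re := by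
  classical
  obtain ⟨hι0, hιC2, T, hT, hGk⟩ := hL n
  have hF : ∀ X, AnalyticAt ℂ (fun u => E n X (χ n X u)) 0 := fun X =>
    analyticOnNhd_piece_chart hC hAn n X 0 (hC n X).2.2.2.1
  have hrepr : (fun B => ((B12PolarizationTensor120.expChart (fam k v (K n)) ρ B : ℝ) : ℂ)) =ᶠ[𝓝 0]
      fun B => ∑ X, (fun u => E n X (χ n X u)) (ιe n B) := hRep n
  set p : Fin (F.P (K n)).d → Site (F.P (K n)) (k + 1) → V :=
    Pi.single (Fin.cast (F.P_d (K n)).symm 0) (Pi.single (siteOfInt F (K n) (k + 1) z) (bV aStar)) with hp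
  set q : Fin (F.P (K n)).d → Site (F.P (K n)) (k + 1) → V :=
    Pi.single (Fin.cast (F.P_d (K n)).symm 1) (Pi.single (siteOfInt F (K n) (k + 1) 0) (bV aStar)) with hq
  have hbridge := (ofReal_fderiv_fderiv_eq_sum_mixedDeriv_of_repr (fun X u => E n X (χ n X u)) (ιe n) _ hrepr hι0 hιC2 hF (hW n) p q).2
  have hpv : (pvolOf F fam ρ bV k v (K n) 0 1 z : ℂ) =
      ∑ X, mixedDeriv (fun u => E n X (χ n X u)) (fderiv ℝ (ιe n) 0 q) (fderiv ℝ (ιe n) 0 p) := by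
    rw [hS n z]; exact hbridge
  -- RowLᵀ♯ + W2♭ + the chart symmetry: swap the honest legs for the tabulated (transverse) legs
  have hswap : ∑ X, mixedDeriv (fun u => E n X (χ n X u)) (fderiv ℝ (ιe n) 0 q) (fderiv ℝ (ιe n) 0 p) =
      ∑ X, mixedDeriv (fun u => E n X (χ n X u)) (R.Gk n (R.e n 1 0)) (R.Gk n (R.e n 0 z)) :=
    sum_mixedDeriv_congr_of_symmGaugeLegs hGI hLoc hfl hC hAn hW n hT (hGk 1 0) (hGk 0 z)
  rw [hswap] at hpv
  have hcutEq : ∀ X (a b : Fin (m n) → ℂ), mixedDeriv (fun u => E n X (χ n X u)) a b =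
      mixedDeriv (fun u => E n X (χ n X u)) (cutTo (R.cX n X) a) (cutTo (R.cX n X) b) := by
    intro X a b
    obtain ⟨T', hT'⟩ := exists_cutTo_clm (R.cX n X)
    have hfun : (fun u => E n X (χ n X u)) = fun u => (fun u => E n X (χ n X u)) (T' u) := by
      funext u; rw [hT']; exact (hLoc n X _ _ fun i hi => (hcut n X u i hi)).symm
    obtain ⟨r, hr, hball⟩ : ∃ r > 0, ∀ y ∈ Metric.ball (0 : Fin (m n) → ℂ) r, DifferentiableAt ℂ (fun u => E n X (χ n X u)) y := by
      obtain ⟨s, hs, hsub⟩ := Metric.mem_nhds_iff.1 (hF X).eventually_analyticAt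
      exact ⟨s, hs, fun y hy => (hsub hy).differentiableAt⟩
    conv_lhs => rw [hfun]
    rw [mixedDeriv_comp_clm hr hball T' a b, hT', hT']
  have hsum : ∑ X, mixedDeriv (fun u => E n X (χ n X u)) (R.Gk n (R.e n 1 0)) (R.Gk n (R.e n 0 z)) =
      ∑ X, mixedDeriv (fun u => E n X (χ n X u)) (cutTo (R.cX n X) (R.Gk n (R.e n 1 0))) (cutTo (R.cX n X) (R.Gk n (R.e n 0 z))) :=
    Finset.sum_congr rfl fun X _ => hcutEq X _ _
  rw [hsum] at hpv
  have := congrArg Complex.re hpv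
  rw [Complex.ofReal_re, Complex.re_sum] at this
  exact this

/-- ★★★ **THE DECAY ROAD ON TRANSVERSE LEGS, `Ad`-SHARPENED (RowLᵀ♯)** — `decay510_plimOf_of_rows_transverse` with the honest legs congruent to the
tabulated ones modulo pure-gauge legs AND one global chart symmetry per member (the root's constant conjugation): same binders otherwise, same conclusion.
[cite: Balaban1987RG1, (5.10) p.293, (4.35)–(4.37) pp.290–291, (4.8) p.283, (4.14)–(4.15) p.284, (1.18)–(1.21) pp.263–264; Balaban1985Variational, Thm 1 p.300
(uniqueness modulo the residual group), Prop. 9 p.309; Balaban1984PropagatorsII, Prop. 2.5] -/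
theorem decay510_plimOf_of_rows_transverseSymm (Uc : (n : ℕ) → (S n).Dom → Set (Fin (M n) → ℂ)) (coords : (n : ℕ) → (S n).Dom → Finset (Fin (M n)))
    (χ : (n : ℕ) → (S n).Dom → (Fin (m n) → ℂ) → (Fin (M n) → ℂ)) (D : (n : ℕ) → (S n).Dom → Set (Fin (m n) → ℂ))
    {Gg P : ℕ → Type*} (act : (n : ℕ) → Gg n → (Fin (M n) → ℂ) → (Fin (M n) → ℂ)) {Hg : ℕ → Type*} (toG : (n : ℕ) → Hg n → Gg n)
    (A : (n : ℕ) → Hg n → ((Fin (m n) → ℂ) →L[ℂ] (Fin (m n) → ℂ))) (gradLeg : (n : ℕ) → P n → (Fin (m n) → ℂ))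
    (R : Response9Data S M m 4) (Nw K : ℕ → ℕ)
    (ιe : (n : ℕ) → (Fin (F.P (K n)).d → Site (F.P (K n)) (k + 1) → V) → (Fin (m n) → ℂ))
    {E₀ κ C₉ δ₀ Mg c₁ K₀ K₁ : ℝ} (hE₀ : 0 ≤ E₀) (hκ : 0 ≤ κ) (hδ₀ : 0 ≤ δ₀) (hMg : 0 < Mg) (hK₀ : 0 ≤ K₀)
    (hA : FormatPlusG S M act Uc coords m χ (fun n => ΦfOf F fam ρ k v (K n)) ιe R.wrap R.emb R.πc E₀ κ)
    (hC : Chart44D S M Uc m χ D) (hEq : ChartEquivariant toG act χ A) (hN : ∀ n, NoInvariantCovector (A n))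
    (hfl : ChartGaugeFlow act coords χ gradLeg)
    (hcut : ∀ n X u, ∀ i ∈ coords n X, χ n X (cutTo (R.cX n X) u) i = χ n X u i)
    (hR : Response9D R χ Nw D C₉ δ₀)
    (hgeo : ∀ n, GeomLeaf (R.G n) (R.ρ n) Mg c₁) (hcube : ∀ n, CubeSumLeaf (R.G n) (δ₀ / 2) K₁) (htree : ∀ n, TreeLeaf (R.Cc n) (κ / 2) K₀)
    (hρ : ∀ (μ ν : Fin 4) (z : Fin 4 → ℤ), ∀ᶠ n in atTop, R.ρ n (R.e n μ 0) (R.e n ν z) = B12Sec2to5.l1 z)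
    (hL : ∀ n, ιe n 0 = 0 ∧ ContDiffAt ℝ 2 (ιe n) 0 ∧ ∃ T : (Fin (m n) → ℂ) →L[ℂ] (Fin (m n) → ℂ), ChartSymm act χ n T ∧
      ∀ (μ : Fin 4) (z : Fin 4 → ℤ), ∃ p : P n,
        fderiv ℝ (ιe n) 0 (Pi.single (Fin.cast (F.P_d (K n)).symm μ) (Pi.single (siteOfInt F (K n) (k + 1) z) (bV aStar))) - T (R.Gk n (R.e n μ z)) =
          gradLeg n p)
    (hS : ∀ (n : ℕ) (z : Fin 4 → ℤ), pvolOf F fam ρ bV k v (K n) 0 1 z =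
      B12PolarizationTensor120.polComp ℝ (B12PolarizationTensor120.expChart (fam k v (K n)) ρ) bV (Fin.cast (F.P_d (K n)).symm 0)
        (siteOfInt F (K n) (k + 1) z) aStar (Fin.cast (F.P_d (K n)).symm 1) (siteOfInt F (K n) (k + 1) 0) aStar)
    (hLim : Limit121 (fun n => pvolOf F fam ρ bV k v (K n)) (plimOf F fam ρ bV k v)) :
    B12Sec2to5.Decay510 (plimOf F fam ρ bV k v 0 1) (16 * E₀ * C₉ ^ 2 * Real.exp (delta1 δ₀ κ Mg * Mg * c₁) * K₀ * K₁) (delta1 δ₀ κ Mg) := by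
  obtain ⟨E, hAn, hB, hLoc, hRep, -, hG⟩ := hA
  have hW : Ward414 χ E := ward414_of_gaugeInv119_chart44D hG hEq hC hAn hN
  have hC₉ : 0 ≤ C₉ := hR.consts_nonneg.1
  refine decay510_of_tendsto (fun n z => pvolOf F fam ρ bV k v (K n) 0 1 z) (fun z => hLim 0 1 z) fun z => ?_
  filter_upwards [hρ 1 0 z] with n hn
  rw [pvolOf_eq_sum_re_mixedDeriv_transverseSymm F fam ρ bV aStar k v Uc coords χ D act gradLeg E R K ιe hAn hLoc hRep hW hG hfl hC hcut hL hS n z,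
    ← hn]
  have hD : ∀ X : (S n).Dom, Convex ℝ (D n X) ∧ Balanced ℂ (D n X) ∧ IsOpen (D n X) ∧ (0 : Fin (m n) → ℂ) ∈ D n X := fun X => by
    obtain ⟨h1, h2, h3, h4, -, -⟩ := hC n X; exact ⟨h1, h2, h3, h4⟩
  have han : ∀ X : (S n).Dom, AnalyticOnNhd ℂ (fun u => E n X (χ n X u)) (D n X) := fun X => analyticOnNhd_piece_chart hC hAn n X
  have h118 : ∀ X : (S n).Dom, ∀ w ∈ D n X, ‖E n X (χ n X w)‖ ≤ E₀ * Real.exp (-κ * (S n).dj X) := fun X w hw => by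
    obtain ⟨-, -, -, -, -, hmaps⟩ := hC n X
    exact (bound118_iff Uc E E₀ κ).1 hB n X _ (hmaps hw)
  exact B12Decay510Gauge.abs_twoPoint_le_of_gauge (R.G n) (ρ := R.ρ n) (fun X u => E n X (χ n X u)) (D n) (fun X y => cutTo (R.cX n X) (R.Gk n y))
    (fun X x y => (mixedDeriv (fun u => E n X (χ n X u)) (cutTo (R.cX n X) (R.Gk n x)) (cutTo (R.cX n X) (R.Gk n y))).re)
    hE₀ hC₉ hK₀ hδ₀ hκ hMg hD han h118 (fun _ _ _ => rfl) (fun X y => hR.decay n X y) (hgeo n) (hcube n) (htree n) _ _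

/-- **COMPATIBILITY ♯ → ᵀ**: the RowLᵀ road is the RowLᵀ♯ road with the identity chart symmetry, available as soon as some named group element acts trivially
(at the record: `u = 1`).  [cite: Balaban1987RG1, (1.10) p.262 (u = 1), (5.10) p.293] -/
theorem decay510_plimOf_of_rows_transverse_of_symm (Uc : (n : ℕ) → (S n).Dom → Set (Fin (M n) → ℂ)) (coords : (n : ℕ) → (S n).Dom → Finset (Fin (M n)))
    (χ : (n : ℕ) → (S n).Dom → (Fin (m n) → ℂ) → (Fin (M n) → ℂ)) (D : (n : ℕ) → (S n).Dom → Set (Fin (m n) → ℂ))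
    {Gg P : ℕ → Type*} (act : (n : ℕ) → Gg n → (Fin (M n) → ℂ) → (Fin (M n) → ℂ)) {Hg : ℕ → Type*} (toG : (n : ℕ) → Hg n → Gg n)
    (A : (n : ℕ) → Hg n → ((Fin (m n) → ℂ) →L[ℂ] (Fin (m n) → ℂ))) (gradLeg : (n : ℕ) → P n → (Fin (m n) → ℂ))
    (e : (n : ℕ) → Gg n) (he : ∀ n u, act n (e n) u = u)
    (R : Response9Data S M m 4) (Nw K : ℕ → ℕ)
    (ιe : (n : ℕ) → (Fin (F.P (K n)).d → Site (F.P (K n)) (k + 1) → V) → (Fin (m n) → ℂ))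
    {E₀ κ C₉ δ₀ Mg c₁ K₀ K₁ : ℝ} (hE₀ : 0 ≤ E₀) (hκ : 0 ≤ κ) (hδ₀ : 0 ≤ δ₀) (hMg : 0 < Mg) (hK₀ : 0 ≤ K₀)
    (hA : FormatPlusG S M act Uc coords m χ (fun n => ΦfOf F fam ρ k v (K n)) ιe R.wrap R.emb R.πc E₀ κ)
    (hC : Chart44D S M Uc m χ D) (hEq : ChartEquivariant toG act χ A) (hN : ∀ n, NoInvariantCovector (A n))
    (hfl : ChartGaugeFlow act coords χ gradLeg)
    (hcut : ∀ n X u, ∀ i ∈ coords n X, χ n X (cutTo (R.cX n X) u) i = χ n X u i)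
    (hR : Response9D R χ Nw D C₉ δ₀)
    (hgeo : ∀ n, GeomLeaf (R.G n) (R.ρ n) Mg c₁) (hcube : ∀ n, CubeSumLeaf (R.G n) (δ₀ / 2) K₁) (htree : ∀ n, TreeLeaf (R.Cc n) (κ / 2) K₀)
    (hρ : ∀ (μ ν : Fin 4) (z : Fin 4 → ℤ), ∀ᶠ n in atTop, R.ρ n (R.e n μ 0) (R.e n ν z) = B12Sec2to5.l1 z)
    (hL : ∀ n, ιe n 0 = 0 ∧ ContDiffAt ℝ 2 (ιe n) 0 ∧ ∀ (μ : Fin 4) (z : Fin 4 → ℤ), ∃ p : P n,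
      fderiv ℝ (ιe n) 0 (Pi.single (Fin.cast (F.P_d (K n)).symm μ) (Pi.single (siteOfInt F (K n) (k + 1) z) (bV aStar))) - R.Gk n (R.e n μ z) =
        gradLeg n p)
    (hS : ∀ (n : ℕ) (z : Fin 4 → ℤ), pvolOf F fam ρ bV k v (K n) 0 1 z =
      B12PolarizationTensor120.polComp ℝ (B12PolarizationTensor120.expChart (fam k v (K n)) ρ) bV (Fin.cast (F.P_d (K n)).symm 0)
        (siteOfInt F (K n) (k + 1) z) aStar (Fin.cast (F.P_d (K n)).symm 1) (siteOfInt F (K n) (k + 1) 0) aStar)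
    (hLim : Limit121 (fun n => pvolOf F fam ρ bV k v (K n)) (plimOf F fam ρ bV k v)) :
    B12Sec2to5.Decay510 (plimOf F fam ρ bV k v 0 1) (16 * E₀ * C₉ ^ 2 * Real.exp (delta1 δ₀ κ Mg * Mg * c₁) * K₀ * K₁) (delta1 δ₀ κ Mg) :=
  decay510_plimOf_of_rows_transverseSymm F fam ρ bV aStar k v Uc coords χ D act toG A gradLeg R Nw K ιe hE₀ hκ hδ₀ hMg hK₀ hA hC hEq hN hfl hcut hR
    hgeo hcube htree hρ (fun n => ⟨(hL n).1, (hL n).2.1, 1, chartSymm_one n (e n) (he n), fun μ z => (hL n).2.2 μ z⟩) hS hLim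

end Road

end Summit.QuantumFields.YangMills.Theorems.K0AxTransverseWard

end
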